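import Summits.FinalStateConjecture.FinalStateConjecture.Theorems.ExactKerrEndsSettlingAlongCensoredKerrEndsMinkowskianSettled
import Literature.Geometry.Lorentzian.SpacelikeGraphRigidityFamily
import Literature.Geometry.Lorentzian.AdmissibleDataLocality
import Literature.Geometry.Lorentzian.TrivialDataAdmissible
import HarnessLib

/-!
# Crux `SettlingAlongCensoredKerrEnds` (stmt-FinalStateConjecture-18520, route `ExactKerrEnds`):
# compactly supported spacelike graph data are ADMISSIBLE and SETTLED — the consequent of `C₂` holds
# on an infinite-dimensional family of non-trivial admissible bases

For `u : ℝ³ → ℝ` of class `C^∞` with `‖du‖ ≤ θ < 1`, the slice `t = u(x)` of Minkowski space carries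
the vacuum data `D_u = (δ − du ⊗ du, (1 − ‖∇u‖²)^{-1/2} ∇∇u)` on `Minkowski.slice = ℝ³`
(`Minkowski.exists_vacuumCauchyDevelopment_graph`, `SpacelikeGraphDevelopment.lean`), whose graph map
makes Minkowski space a vacuum Cauchy development of `D_u`. This file draws the consequences for the
settling crux `C₂` of the route (`Settled D` = every maximal vacuum Cauchy development has complete
`𝓘⁺` and an honest sub-extremal decomposition of `O = exteriorOf` with rays staying, exhaustive
future-oriented charts — `ClusterCompleteness.SettlesT2`):

* `exists_graph_vacuumCauchyDevelopment` — the construction of `SpacelikeGraphDevelopment` re-run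
  with the data hypersurface EXPOSED: the development is Minkowski space and its embedding IS the
  graph map `y ↦ (u(y), y)` (the tree's statement hides the embedding behind an `∃`);
* `exists_settled_graphDatum` — if moreover `u` is bounded above, EVERY maximal vacuum Cauchy
  development of `D_u` settles in the T2 sense (`settled_of_cauchyDevelopment_eq_minkowski`: the slice
  lies below the hyperplane `{x⁰ = sup u}`);
* `exists_admissible_settled_graphDatum` — if `u` is supported in the unit ball, `D_u` is moreover
  ADMISSIBLE (`(h, k) = (δ, 0)` off the closed unit ball, `mem_admissibleVacuumData_of_agree_off_compact`
  from the trivial datum, `trivialData_mem_admissibleVacuumData`), all its maximal vacuum Cauchy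
  developments settle, and through it passes a tame, injective, immersed curve of admissible data with
  settled members off `0` — the CONSEQUENT of `C₂ = SettlingAlongCensoredKerrEnds` at every input curve
  based at `D_u` (`exists_settledCurve_of_cauchyDevelopment_eq_minkowski`).

So the consequent of the crux (and the `∀`-MGHD conjunct of the summit) is kernel-checked on the whole
family `{D_u : u ∈ C_c^∞(B₁), ‖du‖ ≤ θ < 1}` of admissible data — intrinsically curved slices with
`k ≠ 0`, not only the model point `u = 0`. No `sorry`, no definition, no named fact.

References: Christodoulou–Klainerman 1993, Thm. 1.0.2; Beig–Chruściel, J. Math. Phys. 37 (1996),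
Thm. 4.1 and its proof; Wald 1984, §10.2, (10.2.10)–(10.2.13); Choquet-Bruhat 2009, Ch. VI, Thm. 3.3;
Christodoulou, CQG 16 (1999), p. A24; Bartnik, CPAM 39 (1986), §1.
-/

set_option linter.dupNamespace false

noncomputable section

open Set Function Filter TopologicalSpace InnerProductSpace Metric
open scoped Manifold ContDiff Topology RealInnerProductSpace Gradient NNReal

namespace Summit.FinalStateConjecture.FinalStateConjecture.Theorems.ExactKerrEnds

open Literature.Geometry.Lorentzian Literature.Geometry.Lorentzian.Minkowski
open Summit.FinalStateConjecture (HasCompleteNullInfinity exteriorOf RaysStayInClosure HasExhaustiveCharts IsFutureOriented)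
open Summit.FinalStateConjecture.FinalStateConjecture.Theorems.ClusterCompleteness (SettlesT2)

variable {u : E3 → ℝ}

/-! ## §1 The graph development, data hypersurface exposed -/

/-- **Uniformly spacelike entire graphs carry vacuum data of which Minkowski space is a vacuum Cauchy
development ALONG THE GRAPH MAP.** For `u : ℝ³ → ℝ` of class `C^∞` with `‖du‖ ≤ θ < 1` there is an
initial data set `D = (δ − du ⊗ du, (1 − ‖∇u‖²)^{-1/2} ∇∇u)` on `slice`, solving the vacuum
constraints, with a `VacuumCauchyDevelopment` whose space-time is `Minkowski.spacetime` and whose data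
embedding is the graph map `y ↦ (u(y), y)`. This is `Minkowski.exists_vacuumCauchyDevelopment_graph`
(Beig–Chruściel 1996, proof of Thm. 4.1; Wald 1984, §10.2) with the embedding recorded.
[cite: BeigChrusciel1996, Thm. 4.1 and its proof, §4 (last paragraph)] -/
theorem exists_graph_vacuumCauchyDevelopment (hu : ContDiff ℝ ∞ u) {θ : ℝ≥0} (hθ : θ < 1)
    (hb : ∀ y, ‖fderiv ℝ u y‖₊ ≤ θ) :
    ∃ D : InitialDataSet (𝓡 3) slice,
      (∀ (y : slice) (v w : E3), D.h.inner y v w = ⟪v, w⟫ - ⟪∇ u y, v⟫ * ⟪∇ u y, w⟫) ∧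
      (∀ (y : slice) (v w : E3),
        D.k y v w = (Real.sqrt (1 - ‖∇ u y‖ ^ 2))⁻¹ * ⟪fderiv ℝ (∇ u) y v, w⟫) ∧
      (∀ [D.metric.HasLeviCivita], D.IsVacuumConstraintSolution) ∧
      ∃ (𝒟 : VacuumCauchyDevelopment D) (h𝒟 : 𝒟.toSpacetime = Minkowski.spacetime), ∀ y : slice,
        (cast (congrArg LorentzianManifold.carrier (congrArg Spacetime.toLorentzianManifold h𝒟))
          (𝒟.embed y) : E4) = E4.ofTimeSpace (u y) y := by
  haveI := smoothMetric.toPseudoRiemannianMetric.hasLeviCivita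
  have hd : Differentiable ℝ u := hu.differentiable (by simp)
  have hlt : ∀ y, ‖∇ u y‖ < 1 := fun y ↦ by
    rw [gradient, LinearIsometryEquiv.norm_map]
    exact lt_of_le_of_lt (hb y) (by exact_mod_cast hθ)
  have hfi := isSpacelikeImmersion_graph_slice hu hlt
  have hfun := isFutureUnitNormal_graph_slice hd hlt
  have hlift := contMDiff_lift_graph_slice hu hlt
  have hm : Module.finrank ℝ E3 = 3 := finrank_euclideanSpace_fin
  have hm1 : Module.finrank ℝ E4 = 3 + 1 := finrank_euclideanSpace_fin
  obtain ⟨D, hDh, hDk, hvac⟩ :=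
    smoothMetric.toPseudoRiemannianMetric.exists_initialDataSet_induced_isVacuumConstraintSolution
      hfi hfun.1 hlift hm hm1 fun y ↦
        smoothMetric.toPseudoRiemannianMetric.ricci_eq_zero_of_val_eq_const bilin (fun _ ↦ rfl)
          (by decide) _
  refine ⟨D, fun y v w ↦ ?_, fun y v w ↦ ?_, hvac, ?_⟩
  · -- the induced metric `δ − du ⊗ du`
    rw [hDh y, PseudoRiemannianMetric.inducedBilin_apply, mfderiv_graph_slice hd y,
      mfderiv_graph_slice hd y]
    exact bilin_tangent_tangent (∇ u y) v w
  · -- the second fundamental form `c ⟪d(∇u) v, w⟫`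
    have hK : D.k y v w =
        smoothMetric.toPseudoRiemannianMetric.secondFundamentalForm 𝓘(ℝ, E3)
          (fun y : slice ↦ E4.ofTimeSpace (u y) y)
          (fun y : slice ↦ (Real.sqrt (1 - ‖∇ u y‖ ^ 2))⁻¹ • E4.ofTimeSpace 1 (∇ u (y : E3)))
          y v w := by
      rw [← hDk y]
      rfl
    have hf : MDifferentiableAt 𝓘(ℝ, E3) 𝓘(ℝ, E4) (fun y : slice ↦ E4.ofTimeSpace (u y) y) y :=
      (contMDiff_graph_slice hu y).mdifferentiableAt (by simp)
    have hN : DifferentiableAt ℝ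
        (fun y ↦ (Real.sqrt (1 - ‖∇ u y‖ ^ 2))⁻¹ • E4.ofTimeSpace 1 (∇ u y)) y :=
      (contDiff_normalMap hu hlt).differentiable (by simp) y
    have hν : MDifferentiableAt 𝓘(ℝ, E3) 𝓘(ℝ, E4)
        (fun y : slice ↦ (Real.sqrt (1 - ‖∇ u y‖ ^ 2))⁻¹ • E4.ofTimeSpace 1 (∇ u (y : E3))) y :=
      (contMDiff_normal_graph_slice hu hlt y).mdifferentiableAt (by simp)
    rw [hK, ModelSpace.secondFundamentalForm_eq_mfderiv (G₀ := bilin) (fun _ ↦ rfl)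
      BoundarylessManifold.isInteriorPoint hf hν v w, mfderiv_graph_slice hd y,
      OpensChart.mfderiv_eq y _ (fun y ↦ (Real.sqrt (1 - ‖∇ u y‖ ^ 2))⁻¹ •
        E4.ofTimeSpace 1 (∇ u y)) (fun _ ↦ rfl) hN]
    exact bilin_fderiv_normalMap_tangent hu hlt y v w
  · -- the vacuum Cauchy development ALONG THE GRAPH MAP
    have hrange : range (α := spacetime.carrier) (fun y : slice ↦ E4.ofTimeSpace (u y) y) =
        range (α := spacetime.carrier) fun y : E3 ↦ E4.ofTimeSpace (u y) y :=
      Set.ext fun x ↦ ⟨fun ⟨y, hy⟩ ↦ ⟨y, hy⟩, fun ⟨y, hy⟩ ↦ ⟨⟨y, mem_slice y⟩, hy⟩⟩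
    exact ⟨
      { toSpacetime := spacetime
        embed := fun y : slice ↦ E4.ofTimeSpace (u y) y
        isSmoothEmbedding := isSmoothEmbedding_graph_slice hu
        normal := fun y : slice ↦ (Real.sqrt (1 - ‖∇ u y‖ ^ 2))⁻¹ • E4.ofTimeSpace 1 (∇ u (y : E3))
        isFutureUnitNormal := hfun
        induced_h := fun y ↦ (hDh y).symm
        induced_k := fun y ↦ (hDk y).symm
        isCauchyHypersurface := by
          rw [hrange]
          exact isCauchyHypersurface_range_graph_of_fderiv hθ hd hb
        isRicciFlat := @isRicciFlat_holds }, rfl, fun y ↦ rfl⟩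

/-! ## §2 Bounded above: every maximal development settles -/

/-- **Every maximal vacuum Cauchy development of the graph datum `D_u` settles (T2) when `u` is
bounded above**: the data hypersurface `t = u(x)` of the Minkowskian development lies below the
hyperplane `{x⁰ = sup u}` (`settled_of_cauchyDevelopment_eq_minkowski`). Christodoulou–Klainerman
1993, Thm. 1.0.2 (Minkowski space is its own final state). [cite: ChristodoulouKlainerman1993, Thm. 1.0.2] -/
theorem exists_settled_graphDatum (hu : ContDiff ℝ ∞ u) {θ : ℝ≥0} (hθ : θ < 1)
    (hb : ∀ y, ‖fderiv ℝ u y‖₊ ≤ θ) (hT : BddAbove (range u)) :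
    ∃ D : InitialDataSet (𝓡 3) slice,
      (∀ (y : slice) (v w : E3), D.h.inner y v w = ⟪v, w⟫ - ⟪∇ u y, v⟫ * ⟪∇ u y, w⟫) ∧
      (∀ (y : slice) (v w : E3),
        D.k y v w = (Real.sqrt (1 - ‖∇ u y‖ ^ 2))⁻¹ * ⟪fderiv ℝ (∇ u) y v, w⟫) ∧
      (∀ [D.metric.HasLeviCivita], D.IsVacuumConstraintSolution) ∧
      (∃ (𝒟 : VacuumCauchyDevelopment D) (h𝒟 : 𝒟.toSpacetime = Minkowski.spacetime), ∀ y : slice,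
        (cast (congrArg LorentzianManifold.carrier (congrArg Spacetime.toLorentzianManifold h𝒟))
          (𝒟.embed y) : E4) = E4.ofTimeSpace (u y) y) ∧
      ∀ 𝒟' : VacuumCauchyDevelopment D, 𝒟'.IsMaximal → SettlesT2 𝒟' := by
  obtain ⟨D, hh, hk, hvac, 𝒟, h𝒟, hι⟩ := exists_graph_vacuumCauchyDevelopment hu hθ hb
  obtain ⟨T, hT⟩ := hT
  refine ⟨D, hh, hk, hvac, ⟨𝒟, h𝒟, hι⟩, ?_⟩
  refine settled_of_cauchyDevelopment_eq_minkowski 𝒟.toCauchyDevelopment h𝒟 ⟨T, fun y ↦ ?_⟩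
  have h0 : (cast (congrArg LorentzianManifold.carrier (congrArg Spacetime.toLorentzianManifold h𝒟))
      (𝒟.embed y) : E4) 0 = u y := by
    rw [hι y]
    exact E4.ofTimeSpace_apply_zero _ _
  exact h0.le.trans (hT ⟨(y : E3), rfl⟩)

/-! ## §3 Supported in the unit ball: admissible, settled, and the consequent of `C₂` -/

/-- **Compactly supported spacelike graph data are admissible and settled, and the consequent of
`C₂` holds at them.** For `u : ℝ³ → ℝ` of class `C^∞`, supported in the unit ball, with
`‖du‖ ≤ θ < 1`: the vacuum graph datum `D_u = (δ − du ⊗ du, (1 − ‖∇u‖²)^{-1/2} ∇∇u)` on `slice` is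
ADMISSIBLE (`(h, k) = (δ, 0)` off the closed unit ball — `Minkowski.gradient_eq_zero_of_far`,
`fderiv_gradient_eq_zero_of_far` — so admissibility passes from the trivial datum,
`mem_admissibleVacuumData_of_agree_off_compact`); EVERY maximal vacuum Cauchy development of it settles
in the T2 sense (the slice lies below `{x⁰ = sup u}`); and through it passes a tame, injective, immersed
curve of admissible data all of whose members off `0` are settled — the consequent of
`SettlingAlongCensoredKerrEnds` at every input curve based at `D_u`
(`exists_settledCurve_of_cauchyDevelopment_eq_minkowski`). [cite: Christodoulou1999, p. A24] -/
theorem exists_admissible_settled_graphDatum :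
    ∀ (u : E3 → ℝ) (θ : ℝ≥0), ContDiff ℝ ∞ u → θ < 1 → (∀ y, ‖fderiv ℝ u y‖₊ ≤ θ) →
      (∀ y : E3, 1 < ‖y‖ → u y = 0) →
      ∃ D : InitialDataSet (𝓡 3) slice,
        (∀ (y : slice) (v w : E3), D.h.inner y v w = ⟪v, w⟫ - ⟪∇ u y, v⟫ * ⟪∇ u y, w⟫) ∧
        (∀ (y : slice) (v w : E3),
          D.k y v w = (Real.sqrt (1 - ‖∇ u y‖ ^ 2))⁻¹ * ⟪fderiv ℝ (∇ u) y v, w⟫) ∧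
        D ∈ admissibleVacuumData slice ∧
        (∀ 𝒟' : VacuumCauchyDevelopment D, 𝒟'.IsMaximal → SettlesT2 𝒟') ∧
        ∃ (e' : AFEnd slice) (F' : EuclideanSpace ℝ (Fin 1) → InitialDataSet (𝓡 3) slice),
          InitialDataSet.IsTameDataFamily e' 1 F' ∧ F' 0 = D ∧ Injective F' ∧
            InitialDataSet.IsImmersedAtZero 1 F' ∧ (∀ c, F' c ∈ admissibleVacuumData slice) ∧
              ∀ c : EuclideanSpace ℝ (Fin 1), c ≠ 0 →
                ∀ 𝒟' : VacuumCauchyDevelopment (F' c), 𝒟'.IsMaximal →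
                  HasCompleteNullInfinity 𝒟'.toCauchyDevelopment ∧
                    ∃ (O : Set 𝒟'.carrier) (dd : FinalStateDecomposition 𝒟'.toSpacetime O 2),
                      (∀ i, Kerr.IsSubextremal (dd.mass i) (dd.spin i)) ∧
                        O = exteriorOf 𝒟'.toCauchyDevelopment dd.charted ∧
                          RaysStayInClosure 𝒟'.toCauchyDevelopment O ∧ HasExhaustiveCharts dd ∧
                            IsFutureOriented dd := by
  intro u θ hu hθ hb hfar
  -- `u` is continuous with compact support, hence bounded above
  have hsupp : HasCompactSupport u :=
    HasCompactSupport.intro (isCompact_closedBall (0 : E3) 1) fun y hy ↦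
      hfar y (by simpa [mem_closedBall, dist_zero_right] using hy)
  have hbdd : BddAbove (range u) := (hu.continuous).bddAbove_range_of_hasCompactSupport hsupp
  obtain ⟨D, hh, hk, hvac, ⟨𝒟, h𝒟, hι⟩, hS⟩ := exists_settled_graphDatum hu hθ hb hbdd
  -- the data agree with the trivial datum off the (compact) closed unit ball of the slice
  set K : Set slice := (fun y : E3 ↦ (⟨y, mem_slice y⟩ : slice)) '' closedBall (0 : E3) 1 with hK
  have hKc : IsCompact K :=
    (isCompact_closedBall (0 : E3) 1).image (continuous_id.subtype_mk fun y ↦ mem_slice y)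
  have hout : ∀ x : slice, x ∉ K → 1 < ‖(x : E3)‖ := by
    intro x hx
    by_contra hle
    refine hx ⟨x, ?_, rfl⟩
    simpa [mem_closedBall, dist_zero_right] using not_lt.mp hle
  have hadm : D ∈ admissibleVacuumData slice := by
    refine InitialDataSet.mem_admissibleVacuumData_of_agree_off_compact
      trivialData_mem_admissibleVacuumData hvac hKc fun x hx ↦ ⟨?_, ?_⟩
    · ext v w
      rw [hh, trivialData_h_inner, gradient_eq_zero_of_far hfar (hout x hx), inner_zero_left,
        zero_mul, sub_zero]
      exact (innerSL_apply_apply (𝕜 := ℝ) _ _).symm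
    · ext v w
      rw [hk, trivialData_k, fderiv_gradient_eq_zero_of_far hfar (hout x hx), _root_.zero_apply,
        inner_zero_left, mul_zero]
      rfl
  -- the time-bound of the slice, in the form consumed by the Minkowskian lemmas
  have hT : ∃ T : ℝ, ∀ p : slice,
      (cast (congrArg LorentzianManifold.carrier (congrArg Spacetime.toLorentzianManifold h𝒟))
        (𝒟.embed p) : E4) 0 ≤ T := by
    obtain ⟨T, hT⟩ := hbdd
    refine ⟨T, fun y ↦ ?_⟩
    have h0 : (cast (congrArg LorentzianManifold.carrier (congrArg Spacetime.toLorentzianManifold h𝒟))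
        (𝒟.embed y) : E4) 0 = u y := by
      rw [hι y]
      exact E4.ofTimeSpace_apply_zero _ _
    exact h0.le.trans (hT ⟨(y : E3), rfl⟩)
  exact ⟨D, hh, hk, hadm, hS,
    exists_settledCurve_of_cauchyDevelopment_eq_minkowski slice D hadm 𝒟.toCauchyDevelopment h𝒟 hT⟩

end Summit.FinalStateConjecture.FinalStateConjecture.Theorems.ExactKerrEnds

end
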